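import Summits.BirchSwinnertonDyer.BirchSwinnertonDyer.Theorems.ManinLocalTwoThreeThreeBlindInvariance
import HarnessLib

/-!
# A finite CERTIFICATE of non-`3`-blindness: the `t¹`/`t³` coefficients of the intrinsic Kummer series

Summit `BirchSwinnertonDyer`, route `ManinLocalTwoThree` (cell bsd-f2-manin), crux C3 `ManinPrimeToThreeAtNine`
(stmt-BirchSwinnertonDyer-22968), line `kato_shift_three` v9, stubs 4a (LAW₃♮) / 4b (NB₃) of the lead's split
(`…CubeLawNoBlindSplit`).  `3`-BLINDNESS of a point `T♮ = (X₁, Y₁)` of `E♮ = E_{W,1}` is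
`IsThreeAdicFracCube (kummerCubeSeries W 1 X₁ Y₁ X)` — a condition on an infinite series.  THIS FILE gives the first
NECESSARY conditions, decidable from `(X₁, Y₁)` and the tangent slope `α = (3X₁² + a₄♮)/(2Y₁)` alone, so that
NON-blindness (the hypothesis of LAW₃♮; every instance of NB₃) has a finite kernel-checkable certificate:

* `coeff_kummerCubeSeries_intrinsic` — `Θ♮ ≡ −1 − α t + (αX₁ − Y₁) t³ (mod t⁴)` (`t²x(t) ≡ 1 (mod t⁴)` when
  `a₁ = a₂ = a₃ = 0`);
* `threeBlind_necessary` — if `E♮` is `3`-integral (`a₄♮, a₆♮ ∈ ℤ₃`, automatic at additive `3`) and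
  `X₁, Y₁, α ∈ ℤ₃`, then `3`-blindness forces **`3 ∣ α` and `Y₁ ≡ α/3 (mod 3)`** (in `ℤ₃`): a cube `Θ♮ = H³` in
  `ℤ₃⟦t⟧` (UFD step) has `H(0) = −1` (the only cube root of `−1` in `ℤ₃`), `3h₁ = −α`, `h₂ = h₁²`,
  `3h₃ − 5h₁³ = αX₁ − Y₁`, and `h³ ≡ h (mod 3)`;
* `not_threeBlind_of_certificate` — the contrapositive, and `…_of_nine_dvd` its form at a datum with `9 ∣ N`
  (integrality of `E♮` from p3's `exists_padicInt_shortModel_three`).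

an's census (MEMO-an §56.7): the cube root first leaves `ℤ₃` at `t³` for 396 of the 496 rational `3`-torsion points on
optimal curves with `9 ∣ N ≤ 5000` (this certificate) and at `t⁹` for the other 100 (e.g. `y² + 3xy + 4y = x³`); the
blind points off the optimal curve (27a4, `T = (3,0)`) pass it.  Nothing about BSD or Manin's conjecture is proved. [folklore]
-/

set_option autoImplicit false
set_option linter.dupNamespace false

noncomputable section

open scoped Classical
open PowerSeries WeierstrassCurve Literature.NumberTheory.EllipticCurves Literature.NumberTheory.EllipticCurves.ModularForms
  Literature.RingTheory.FormalGroups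
open Summit.BirchSwinnertonDyer.Rank1Residual.ManinAdditive.CuspidalKummer
  Summit.BirchSwinnertonDyer.Rank1Residual.ManinAdditive.CuspidalKummerThree

namespace Summit.BirchSwinnertonDyer.BirchSwinnertonDyer.Theorems.ManinLocalTwoThree

/-! ### §1 Arithmetic in `ℤ₃`: `h³ ≡ h (mod 3)`; `−1` has a unique cube root -/

/-- Fermat in `ℤ₃`: `3 ∣ h³ − h`. [folklore] -/
theorem three_dvd_pow_three_sub_self (h : ℤ_[3]) : (3 : ℤ_[3]) ∣ h ^ 3 - h := by
  have hker : h ^ 3 - h ∈ RingHom.ker (PadicInt.toZMod (p := 3)) := by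
    rw [RingHom.mem_ker, map_sub, map_pow]
    generalize PadicInt.toZMod (p := 3) h = z
    revert z; decide
  rw [PadicInt.ker_toZMod, PadicInt.maximalIdeal_eq_span_p, Ideal.mem_span_singleton] at hker
  exact_mod_cast hker

/-- `x² − x + 1` has no zero in `ℤ₃` (none modulo `9`). [folklore] -/
theorem sq_sub_add_one_ne_zero (x : ℤ_[3]) : x ^ 2 - x + 1 ≠ 0 := by
  intro h0
  have h9 : PadicInt.toZModPow (p := 3) 2 (x ^ 2 - x + 1) = 0 := by rw [h0, map_zero]
  rw [map_add, map_sub, map_pow, map_one] at h9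
  revert h9
  generalize PadicInt.toZModPow (p := 3) 2 x = z
  revert z; decide

/-- The only cube root of `−1` in `ℤ₃` is `−1` (`x³ + 1 = (x + 1)(x² − x + 1)`). [folklore] -/
theorem eq_neg_one_of_pow_three_eq_neg_one {x : ℤ_[3]} (h : x ^ 3 = -1) : x = -1 := by
  have hf : (x + 1) * (x ^ 2 - x + 1) = 0 := by linear_combination h
  rcases mul_eq_zero.mp hf with h1 | h1
  · linear_combination h1
  · exact absurd h1 (sq_sub_add_one_ne_zero x)

/-! ### §2 Low coefficients: `t²x(t) ≡ 1 (mod t⁴)` for `a₁ = a₂ = a₃ = 0`, and cubes up to `t³` -/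

section Coeff

variable {R : Type*} [CommRing R]

/-- `[tⁿ](f·g) = Σ_{k ≤ n} [tᵏ]f · [tⁿ⁻ᵏ]g`. [folklore] -/
private theorem coeff_mul_sum_range' (f g : R⟦X⟧) (n : ℕ) :
    coeff n (f * g) = ∑ k ∈ Finset.range (n + 1), coeff k f * coeff (n - k) g := by
  rw [coeff_mul, Finset.Nat.sum_antidiagonal_eq_sum_range_succ_mk]

/-- The coefficients `t⁰, t¹, t², t³` of a cube `H³`, with `h₀ = H(0)`. [folklore] -/
private theorem coeff_cube_le_three (H : R⟦X⟧) :
    coeff 0 (H ^ 3) = coeff 0 H ^ 3 ∧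
    coeff 1 (H ^ 3) = 3 * coeff 0 H ^ 2 * coeff 1 H ∧
    coeff 2 (H ^ 3) = 3 * coeff 0 H ^ 2 * coeff 2 H + 3 * coeff 0 H * coeff 1 H ^ 2 ∧
    coeff 3 (H ^ 3) = 3 * coeff 0 H ^ 2 * coeff 3 H + 6 * coeff 0 H * coeff 1 H * coeff 2 H + coeff 1 H ^ 3 := by
  have h3 : H ^ 3 = H * (H * H) := by ring
  refine ⟨?_, ?_, ?_, ?_⟩ <;>
  · rw [h3]
    simp only [coeff_mul_sum_range', Finset.sum_range_succ, Finset.sum_range_zero, zero_add, Nat.sub_self,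
      Nat.reduceSub, Nat.sub_zero]
    ring

end Coeff

section CoeffPadic

/-- On a model with `a₁ = a₂ = a₃ = 0` over `ℤ₃`, `t²x(t) ≡ 1 (mod t⁴)`: coefficients `1, 0, 0, 0`.
[Silverman AEC IV.1] [folklore] -/
theorem coeff_formalXMulSq_le_three (V : WeierstrassCurve ℤ_[3]) (h₁ : V.a₁ = 0) (h₂ : V.a₂ = 0) (h₃ : V.a₃ = 0) :
    coeff 0 V.formalXMulSq = 1 ∧ coeff 1 V.formalXMulSq = 0 ∧ coeff 2 V.formalXMulSq = 0 ∧
      coeff 3 V.formalXMulSq = 0 := by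
  haveI : V.IsCharNeTwoNF := ⟨h₁, h₃⟩
  have x0 : coeff 0 V.formalXMulSq = 1 := by
    rw [coeff_zero_eq_constantCoeff]; exact V.constantCoeff_formalXMulSq
  have x1 : coeff 1 V.formalXMulSq = 0 := V.coeff_formalXMulSq_eq_zero_of_odd odd_one
  have x3 : coeff 3 V.formalXMulSq = 0 := V.coeff_formalXMulSq_eq_zero_of_odd (by decide)
  refine ⟨x0, x1, ?_, x3⟩
  have hchart := congrArg (coeff 2) V.formalXMulSq_sq_eq
  rw [h₁, h₂, h₃] at hchart
  simp only [map_zero, zero_mul, add_zero, map_add] at hchart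
  rw [show (C V.a₄ * X ^ 4 * V.formalXMulSq : ℤ_[3]⟦X⟧) = C V.a₄ * (X ^ 4 * V.formalXMulSq) by ring,
    coeff_C_mul, coeff_X_pow_mul', if_neg (by norm_num), mul_zero, add_zero, coeff_C_mul_X_pow,
    if_neg (by norm_num), add_zero,
    show V.formalXMulSq ^ 3 = V.formalXMulSq * (V.formalXMulSq * V.formalXMulSq) by ring,
    show V.formalXMulSq ^ 2 = V.formalXMulSq * V.formalXMulSq by ring] at hchart
  simp only [coeff_mul_sum_range', Finset.sum_range_succ, Finset.sum_range_zero, zero_add, Nat.sub_self,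
    Nat.reduceSub, Nat.sub_zero, x0, x1, mul_one, one_mul, mul_zero, add_zero] at hchart
  linear_combination -hchart

/-- **`Θ♮ ≡ −1 − αt + (αX₁ − Y₁)t³ (mod t⁴)`** for the tangent-line Kummer series in the formal parameter of a model
`V` with `a₁ = a₂ = a₃ = 0` (written for the generic expression; `kummerCubeSeries W 1 X₁ Y₁ X` is the case
`V = E♮`). [folklore] -/
theorem coeff_kummerCube_generic_le_three (V : WeierstrassCurve ℤ_[3]) (h₁ : V.a₁ = 0) (h₂ : V.a₂ = 0)
    (h₃ : V.a₃ = 0) (x y a : ℤ_[3]) :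
    let Θ : ℤ_[3]⟦X⟧ := V.formalYMulCube - C y * X ^ 3 - C a * (V.formalXMulSq * X - C x * X ^ 3)
    coeff 0 Θ = -1 ∧ coeff 1 Θ = -a ∧ coeff 2 Θ = 0 ∧ coeff 3 Θ = a * x - y := by
  intro Θ
  obtain ⟨x0, x1, x2, x3⟩ := coeff_formalXMulSq_le_three V h₁ h₂ h₃
  have hY : V.formalYMulCube = -V.formalXMulSq := rfl
  have e : Θ = -V.formalXMulSq - C a * (X ^ 1 * V.formalXMulSq) + C (a * x - y) * X ^ 3 := by
    show V.formalYMulCube - C y * X ^ 3 - C a * (V.formalXMulSq * X - C x * X ^ 3) = _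
    rw [hY, map_sub, map_mul]; ring
  rw [e]
  refine ⟨?_, ?_, ?_, ?_⟩ <;>
  · simp only [LinearMap.map_add, LinearMap.map_sub, LinearMap.map_neg, coeff_C_mul, coeff_X_pow_mul']
    norm_num [x0, x1, x2, x3]

end CoeffPadic

/-! ### §3 The certificate -/

/-- **Necessary conditions for `3`-blindness** (generic `3`-integral form).  Let `V/ℤ₃` with `a₁ = a₂ = a₃ = 0` and
`x, y, a ∈ ℤ₃`.  If `Θ = z³y(z) − y z³ − a(z²x(z)·z − x z³)` is a cube in `Frac ℤ₃⟦z⟧` (witnesses over `ℤ₃`),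
then `3 ∣ a` and `3 ∣ y − a/3`. [folklore] -/
theorem three_dvd_of_isCube_kummerCube_generic (V : WeierstrassCurve ℤ_[3]) (h₁ : V.a₁ = 0) (h₂ : V.a₂ = 0)
    (h₃ : V.a₃ = 0) (x y a : ℤ_[3]) {A B : ℤ_[3]⟦X⟧} (hB : B ≠ 0)
    (hcube : (V.formalYMulCube - C y * X ^ 3 - C a * (V.formalXMulSq * X - C x * X ^ 3)) * B ^ 3 = A ^ 3) :
    ∃ a' : ℤ_[3], a = 3 * a' ∧ (3 : ℤ_[3]) ∣ y - a' := by
  set Θ : ℤ_[3]⟦X⟧ := V.formalYMulCube - C y * X ^ 3 - C a * (V.formalXMulSq * X - C x * X ^ 3) with hΘ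
  obtain ⟨H, hH⟩ := exists_eq_pow_of_mul_pow_eq_pow three_pos hB hcube
  obtain ⟨c0, c1, c2, c3⟩ := coeff_kummerCube_generic_le_three V h₁ h₂ h₃ x y a
  obtain ⟨k0, k1, k2, k3⟩ := coeff_cube_le_three H
  rw [← hΘ] at c0 c1 c2 c3
  rw [hH] at c0 c1 c2 c3
  -- `H(0) = −1`
  have hh0 : coeff 0 H = -1 := eq_neg_one_of_pow_three_eq_neg_one (by rw [← k0, c0])
  rw [hh0] at k1 k2 k3
  -- `3h₁ = −a`, `h₂ = h₁²`, `3h₃ − 5h₁³ = a x − y`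
  have e1 : 3 * coeff 1 H = -a := by linear_combination k1.symm.trans c1
  have e2 : coeff 2 H = coeff 1 H ^ 2 := by
    have h := k2.symm.trans c2
    have h3 : (3 : ℤ_[3]) ≠ 0 := by norm_num
    have : (3 : ℤ_[3]) * (coeff 2 H - coeff 1 H ^ 2) = 0 := by linear_combination h
    rcases mul_eq_zero.mp this with h' | h'
    · exact absurd h' h3
    · linear_combination h'
  have e3 : 3 * coeff 3 H - 5 * coeff 1 H ^ 3 = a * x - y := by
    rw [e2] at k3; linear_combination k3.symm.trans c3
  obtain ⟨m, hm⟩ := three_dvd_pow_three_sub_self (coeff 1 H)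
  refine ⟨-coeff 1 H, by linear_combination e1, ⟨-x * coeff 1 H - coeff 3 H + 5 * m + 2 * coeff 1 H, ?_⟩⟩
  linear_combination e3 + x * e1 + 5 * hm

/-- **The certificate for `E♮ = E_{W,1}`**: if `a₄♮, a₆♮` are `3`-integral (automatic when `W` is additive at `3`)
and `X₁, Y₁, α = tangentSlope W 1 X₁ Y₁` are `3`-integral, then `3`-blindness of `(X₁, Y₁)` forces
`‖α/3‖₃ ≤ 1` and `‖(Y₁ − α/3)/3‖₃ ≤ 1`. [folklore] -/
theorem threeBlind_necessary (W : WeierstrassCurve ℚ)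
    (hA : ‖(((shortModel W 1).a₄ : ℚ) : ℚ_[3])‖ ≤ 1) (hB : ‖(((shortModel W 1).a₆ : ℚ) : ℚ_[3])‖ ≤ 1)
    {X₁ Y₁ : ℚ} (hX : ‖((X₁ : ℚ) : ℚ_[3])‖ ≤ 1) (hY : ‖((Y₁ : ℚ) : ℚ_[3])‖ ≤ 1)
    (hα : ‖((tangentSlope W 1 X₁ Y₁ : ℚ) : ℚ_[3])‖ ≤ 1)
    (hb : IsThreeAdicFracCube (kummerCubeSeries W 1 X₁ Y₁ X)) :
    ‖((tangentSlope W 1 X₁ Y₁ / 3 : ℚ) : ℚ_[3])‖ ≤ 1 ∧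
      ‖(((Y₁ - tangentSlope W 1 X₁ Y₁ / 3) / 3 : ℚ) : ℚ_[3])‖ ≤ 1 := by
  set α := tangentSlope W 1 X₁ Y₁ with hαdef
  -- the `3`-integral model
  set A₀ : ℤ_[3] := ⟨_, hA⟩ with hA₀
  set B₀ : ℤ_[3] := ⟨_, hB⟩ with hB₀
  set V : WeierstrassCurve ℤ_[3] := ⟨0, 0, 0, A₀, B₀⟩ with hVdef
  have hrat : ∀ q : ℚ, algebraMap ℚ ℚ_[3] q = (q : ℚ_[3]) := fun q => by rw [eq_ratCast]
  have hVE : V.map PadicInt.Coe.ringHom = (shortModel W 1).map (algebraMap ℚ ℚ_[3]) := by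
    ext <;> simp [hVdef, shortModel, hA₀, hB₀, hrat]
  set x : ℤ_[3] := ⟨_, hX⟩ with hxdef
  set y : ℤ_[3] := ⟨_, hY⟩ with hydef
  set a : ℤ_[3] := ⟨_, hα⟩ with hadef
  -- read `Θ♮` on `V`
  set ΘV : ℤ_[3]⟦X⟧ := V.formalYMulCube - C y * X ^ 3 - C a * (V.formalXMulSq * X - C x * X ^ 3) with hΘV
  have hmapΘ : PowerSeries.map (Rat.castHom ℚ_[3]) (kummerCubeSeries W 1 X₁ Y₁ X) =
      PowerSeries.map PadicInt.Coe.ringHom ΘV := by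
    rw [Subsingleton.elim (Rat.castHom ℚ_[3]) (algebraMap ℚ ℚ_[3])]
    have hY1 : (shortModel W 1).formalYMulCube = -(shortModel W 1).formalXMulSq := rfl
    have hYV : V.formalYMulCube = -V.formalXMulSq := rfl
    have hXS : PowerSeries.map (algebraMap ℚ ℚ_[3]) (shortModel W 1).formalXMulSq =
        PowerSeries.map PadicInt.Coe.ringHom V.formalXMulSq := by
      rw [map_formalXMulSq, map_formalXMulSq, hVE]
    rw [kummerCubeSeries, X_subst, X_subst, hY1, hΘV, hYV, ← hαdef]
    simp only [smul_eq_C_mul, map_sub, map_neg, map_mul, map_pow, PowerSeries.map_C, PowerSeries.map_X, hXS, hrat]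
    have ex : (PadicInt.Coe.ringHom (p := 3)) x = ((X₁ : ℚ) : ℚ_[3]) := rfl
    have ey : (PadicInt.Coe.ringHom (p := 3)) y = ((Y₁ : ℚ) : ℚ_[3]) := rfl
    have ea : (PadicInt.Coe.ringHom (p := 3)) a = ((α : ℚ) : ℚ_[3]) := rfl
    rw [ex, ey, ea]
  -- the cube in `ℤ₃⟦X⟧`
  obtain ⟨A, B, hBne, hcube⟩ := hb
  rw [hmapΘ] at hcube
  have hκinj : Function.Injective (PowerSeries.map (PadicInt.Coe.ringHom (p := 3))) :=
    PowerSeries.map_injective _ (fun u v h => PadicInt.ext h)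
  have hcubeZ : ΘV * B ^ 3 = A ^ 3 := hκinj (by simpa only [map_mul, map_pow] using hcube)
  obtain ⟨a', ha', hdvd⟩ := three_dvd_of_isCube_kummerCube_generic V rfl rfl rfl x y a hBne hcubeZ
  -- back to `ℚ`
  have h3c : ((3 : ℤ_[3]) : ℚ_[3]) = 3 := by exact_mod_cast PadicInt.coe_natCast 3
  have eαQ : ((α : ℚ) : ℚ_[3]) = 3 * ((a' : ℤ_[3]) : ℚ_[3]) := by
    have : ((α : ℚ) : ℚ_[3]) = ((a : ℤ_[3]) : ℚ_[3]) := rfl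
    rw [this, ha', PadicInt.coe_mul, h3c]
  obtain ⟨m, hm⟩ := hdvd
  have eyQ : ((Y₁ : ℚ) : ℚ_[3]) = ((a' : ℤ_[3]) : ℚ_[3]) + 3 * ((m : ℤ_[3]) : ℚ_[3]) := by
    have : ((Y₁ : ℚ) : ℚ_[3]) = ((y : ℤ_[3]) : ℚ_[3]) := rfl
    rw [this, show y = a' + 3 * m by linear_combination hm, PadicInt.coe_add, PadicInt.coe_mul, h3c]
  have h3 : (3 : ℚ_[3]) ≠ 0 := by norm_num
  have eα : ((α / 3 : ℚ) : ℚ_[3]) = ((a' : ℤ_[3]) : ℚ_[3]) := by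
    push_cast; rw [eαQ]; field_simp
  have eY : (((Y₁ - α / 3) / 3 : ℚ) : ℚ_[3]) = ((m : ℤ_[3]) : ℚ_[3]) := by
    push_cast; rw [eyQ, eαQ]; field_simp; ring
  exact ⟨eα ▸ a'.2, eY ▸ m.2⟩

/-- **Certificate of NON-blindness (contrapositive).**  With `3`-integral `a₄♮, a₆♮, X₁, Y₁, α`: if `3 ∤ α`, or
`3 ∣ α` but `Y₁ ≢ α/3 (mod 3)`, then `(X₁, Y₁)` is not `3`-blind. [folklore] -/
theorem not_threeBlind_of_certificate (W : WeierstrassCurve ℚ)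
    (hA : ‖(((shortModel W 1).a₄ : ℚ) : ℚ_[3])‖ ≤ 1) (hB : ‖(((shortModel W 1).a₆ : ℚ) : ℚ_[3])‖ ≤ 1)
    {X₁ Y₁ : ℚ} (hX : ‖((X₁ : ℚ) : ℚ_[3])‖ ≤ 1) (hY : ‖((Y₁ : ℚ) : ℚ_[3])‖ ≤ 1)
    (hα : ‖((tangentSlope W 1 X₁ Y₁ : ℚ) : ℚ_[3])‖ ≤ 1)
    (hcert : 1 < ‖((tangentSlope W 1 X₁ Y₁ / 3 : ℚ) : ℚ_[3])‖ ∨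
      1 < ‖(((Y₁ - tangentSlope W 1 X₁ Y₁ / 3) / 3 : ℚ) : ℚ_[3])‖) :
    ¬ IsThreeAdicFracCube (kummerCubeSeries W 1 X₁ Y₁ X) := fun hb => by
  obtain ⟨h1, h2⟩ := threeBlind_necessary W hA hB hX hY hα hb
  rcases hcert with h | h
  · exact absurd h1 (not_le.mpr h)
  · exact absurd h2 (not_le.mpr h)

/-- **At a datum with `9 ∣ N` the integrality of `E♮` is automatic** (additive reduction at `3`; p3's
`exists_padicInt_shortModel_three`): the certificate with only `X₁, Y₁, α` to check. [folklore] -/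
theorem not_threeBlind_of_certificate_of_nine_dvd (W : WeierstrassCurve ℚ) [W.IsElliptic] [W.IsGloballyMinimal]
    {N : ℕ} [NeZero N] (D : ModularParametrizationData W N) (h9 : 9 ∣ N)
    {X₁ Y₁ : ℚ} (hX : ‖((X₁ : ℚ) : ℚ_[3])‖ ≤ 1) (hY : ‖((Y₁ : ℚ) : ℚ_[3])‖ ≤ 1)
    (hα : ‖((tangentSlope W 1 X₁ Y₁ : ℚ) : ℚ_[3])‖ ≤ 1)
    (hcert : 1 < ‖((tangentSlope W 1 X₁ Y₁ / 3 : ℚ) : ℚ_[3])‖ ∨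
      1 < ‖(((Y₁ - tangentSlope W 1 X₁ Y₁ / 3) / 3 : ℚ) : ℚ_[3])‖) :
    ¬ IsThreeAdicFracCube (kummerCubeSeries W 1 X₁ Y₁ X) := by
  obtain ⟨ha3, hN3⟩ := lFunction_three_eq_zero_of_nine_dvd W D.isNewformOf h9
  obtain ⟨hΔ3, hc₄3⟩ := three_dvd_Δ_and_c₄_of_hasAdditiveReductionAt W
    (hasAdditiveReductionAt_three_of_lFunction_three_eq_zero W ha3 hN3)
  obtain ⟨V, -, -, -, hVE, -, -, -⟩ := exists_padicInt_shortModel_three W hΔ3 hc₄3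
  have hrat : ∀ q : ℚ, algebraMap ℚ ℚ_[3] q = (q : ℚ_[3]) := fun q => by rw [eq_ratCast]
  have hA : ‖(((shortModel W 1).a₄ : ℚ) : ℚ_[3])‖ ≤ 1 := by
    have h := congrArg WeierstrassCurve.a₄ hVE
    rw [map_a₄, map_a₄, hrat] at h
    rw [← h]; exact PadicInt.norm_le_one _
  have hB : ‖(((shortModel W 1).a₆ : ℚ) : ℚ_[3])‖ ≤ 1 := by
    have h := congrArg WeierstrassCurve.a₆ hVE
    rw [map_a₆, map_a₆, hrat] at h
    rw [← h]; exact PadicInt.norm_le_one _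
  exact not_threeBlind_of_certificate W hA hB hX hY hα hcert

end Summit.BirchSwinnertonDyer.BirchSwinnertonDyer.Theorems.ManinLocalTwoThree

end
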